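import Mathlib
import HarnessLib
import Literature.Analysis.Convex.ConvexMetricProjection
import Literature.Analysis.Convex.SchauderFixedPoint

/-!
# Convexity of Chebyshev sets (Deutsch 2001, Chapter 12)

Literature anchor transcribing F. Deutsch, *Best Approximation in Inner Product Spaces*, CMS Books
in Mathematics 7, Springer (2001), Chapter 12 "Convexity of Chebyshev sets" [Deutsch2001], with
the pieces of Chapters 2–3 it rests on, for a subset `K` of a real inner product space `E`
(the norm-only statements are recorded in a real normed space):

* `IsChebyshevProj K P` — `K` is a **Chebyshev set** with **metric projection** `P : E → E`:
  `P x ∈ K` is the unique best approximation to `x` from `K` (Def. 2.1); `IsChebyshevSet K` — the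
  set-only form ("each `x` has exactly one best approximation in `K`"), equivalent to
  `∃ P, IsChebyshevProj K P` (`isChebyshevSet_iff_exists_proj`). A Chebyshev set is nonempty and
  closed (Thm. 3.1), `‖x − P x‖ = d(x, K)`, and `P x = x` on `K`.
* Lemma 12.1 (`IsChebyshevProj.proj_add_smul_eq`, `proj_eq_of_mem_segment`): every point of the
  segment `[x, P x]` has `P x` as its best approximation.
* Def. 12.2 (`IsSun P`): the Chebyshev set with metric projection `P` is a **sun** if
  `P (x + t (x − P x)) = P x` for all `x` and `t ≥ 0` (Klee 1953, Efimov–Stechkin 1958).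
* Theorem 12.3 (suns and convex Chebyshev sets are equivalent): convex `⟹` sun
  (`IsChebyshevProj.isSun_of_convex`) `⟹` `P x` is the nearest point to `x` of every segment
  `[y, P x]`, `y ∈ K` (`IsSun.norm_sub_proj_le`) `⟹` the variational inequality
  `⟪x − P x, y − P x⟫ ≤ 0` on `K` (`IsSun.inner_sub_proj_le_zero`) `⟹` `P` firmly nonexpansive and
  nonexpansive (`IsSun.norm_proj_sub_proj_sq_le_inner`, `IsSun.norm_proj_sub_proj_le`) `⟹`
  convex (`IsChebyshevProj.convex_of_nonexpansive`, Phelps 1957); summarised in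
  `IsChebyshevProj.convex_iff_isSun` and `IsChebyshevProj.convex_iff_nonexpansive`.
* Def. 3.3 / Def. 3.10 (`IsApproxCompact`, `IsBoundedlyCompact`), Lemma 3.11 (2) ⟹ (3)
  (`IsBoundedlyCompact.isApproxCompact`), Thm. 3.12 (`IsBoundedlyCompact.of_isClosed`: closed
  sets of a finite-dimensional space are boundedly compact) and Lemma 12.4
  (`IsChebyshevProj.continuous`): the metric projection onto an approximatively compact Chebyshev
  set is continuous.
* **Theorem 12.6** (`IsChebyshevProj.isSun_of_isBoundedlyCompact`,
  `IsChebyshevProj.convex_of_isBoundedlyCompact`; Vlasov 1961, Klee 1961): every boundedly compact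
  Chebyshev set is a sun (in any real normed space — Ch. 12, Exercise 7) and hence, in a real
  inner product space, convex.  Proof as printed: if `K` were not a sun, at the farthest point
  `x₁` of a ray `{x + t (x − P x)}` still projecting to `P x` the map
  `F y = x₁ + (r/‖x₁ − P y‖)(x₁ − P y)` is a continuous self-map of the ball `B[x₁, r]`
  (`r = d(x₁, K)/2`) with relatively compact range, so it has a fixed point by **Schauder's fixed
  point theorem** (Theorem 12.5; here the tree's
  `Literature.Analysis.Convex.exists_fixedPoint_of_mapsTo_isCompact`), and Lemma 12.1 then
  produces a point beyond `x₁` on the ray projecting to `P x₁`, a contradiction.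
* **Theorem 12.7** (`IsChebyshevProj.convex_of_finiteDimensional`,
  `isChebyshevSet_iff_isClosed_and_convex`; Bunt 1934, Motzkin 1935, Kritikos 1938): in a
  finite-dimensional real inner product space a nonempty set is a Chebyshev set iff it is closed
  and convex; the "if" direction is Theorem 3.4 (2) / Theorem 3.5
  (`isChebyshevProj_proj`, `exists_isChebyshevProj_of_isComplete`,
  `exists_isChebyshevProj_of_convex`: complete, resp. closed in a Hilbert space, convex sets are
  Chebyshev, with metric projection the tree's `ConvexMetricProjection.proj K`).

Deviations from the printed text, declared: (i) the metric projection is carried as an explicit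
function `P : E → E` with the predicate `IsChebyshevProj K P` rather than as a set-valued map, and
`IsSun` is phrased through `P` alone; (ii) "boundedly compact" (Def. 3.10, sequential) is rendered
as "`K ∩ B[0, r]` is compact for every `r`", equivalent in metric spaces, while "approximatively
compact" (Def. 3.3) is the printed sequential condition; (iii) in Theorem 12.3 the implication
(4) ⟹ (1) is proved for a general point `a x + b y` of a segment by the equality case of the
triangle inequality computed with inner products, instead of the printed reduction to midpoints,
and the chain (2) ⟹ (3) ⟹ (4) passes through the variational inequality, which the printed proof
of (3) ⟹ (4) invokes via Theorem 4.1; (iv) Theorem 12.6's ray parameter `λ₁` is realised as the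
supremum of the closed bounded set `{t ≥ 0 | P (x + t (x − P x)) = P x}`, and Lemma 12.1 and the
sun half of Theorem 12.6 are stated in a real normed space because their printed proofs use only
the norm (Ch. 12, Exercise 7). Whether every Chebyshev set in an infinite-dimensional Hilbert space
is convex is open (Deutsch, Ch. 12, "Question"), and nothing here bears on it.

## Mathlib / tree search

`lean search` / `find` over Mathlib + Literature + Summits for "Chebyshev set", `IsChebyshev`,
`IsSun`, "sun", "boundedly compact", "approximatively compact", Efimov, Stechkin, Vlasov, Motzkin,
Bunt: no declaration about Chebyshev sets of approximation theory (Mathlib has the existence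
theorem `exists_norm_eq_iInf_of_complete_convex`, the Kolmogorov criterion
`norm_eq_iInf_iff_real_inner_le_zero` and `Metric.infDist`; every `Chebyshev*` module in the tree
concerns Chebyshev polynomials, the functions `ψ`, `θ`, or Chebyshev's inequalities). The convex
side of the theory — the metric projection `proj K` onto a complete convex set, Thm. 2.4, 3.4, 4.1,
5.5 — is the tree's `Literature.Analysis.Convex.ConvexMetricProjection`, which this file imports
and does not repeat (its `inner_sub_proj_le_zero` / `norm_proj_sub_proj_sq_le_inner` assume `K`
convex and complete; the present `IsSun.*` versions assume a sun and conclude convexity). The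
Schauder fixed point theorem used is the tree's `Literature.Analysis.Convex.SchauderFixedPoint`
(proved there from Brouwer's theorem).

## References

* F. Deutsch, *Best Approximation in Inner Product Spaces*, CMS Books in Mathematics 7, Springer,
  New York (2001): Ch. 2 Def. 2.1, Thm. 2.4; Ch. 3 Thm. 3.1, Def. 3.3, Thm. 3.4, Thm. 3.5,
  Def. 3.10, Lemma 3.11, Thm. 3.12; Ch. 12 Lemma 12.1 – Theorem 12.7, Exercise 7 and the
  Historical Notes. [Deutsch2001]
* L. P. Vlasov, *Chebyshev sets in Banach spaces*, Soviet Math. Dokl. 2 (1961) 1373–1374;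
  V. Klee, *Convexity of Chebyshev sets*, Math. Ann. 142 (1961) 292–304; N. V. Efimov and
  S. B. Stechkin, *Some properties of Chebyshev sets*, Dokl. Akad. Nauk SSSR 118 (1958) 17–19;
  R. R. Phelps, *Convex sets and nearest points*, Proc. Amer. Math. Soc. 8 (1957) 790–797 — all
  cited through [Deutsch2001], Ch. 12 Historical Notes.
-/

noncomputable section

open Metric Set Filter
open scoped RealInnerProductSpace Topology

namespace Literature.Analysis.Convex.ChebyshevSetConvexity

variable {E : Type*} [NormedAddCommGroup E]

/-! ### Chebyshev sets and their metric projections (Def. 2.1) -/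

/-- `K` is a **Chebyshev set** with **metric projection** `P`: for every `x`, `P x ∈ K` is a best
approximation to `x` from `K` (`‖x − P x‖ ≤ ‖x − y‖` for all `y ∈ K`) and the only one
(any `y ∈ K` with `‖x − y‖ ≤ ‖x − P x‖` equals `P x`). [cite: Deutsch2001, Def. 2.1] -/
structure IsChebyshevProj (K : Set E) (P : E → E) : Prop where
  mem : ∀ x, P x ∈ K
  norm_le : ∀ x, ∀ ⦃y⦄, y ∈ K → ‖x - P x‖ ≤ ‖x - y‖
  unique : ∀ x, ∀ ⦃y⦄, y ∈ K → ‖x - y‖ ≤ ‖x - P x‖ → y = P x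

/-- `K` is a **Chebyshev set**: every `x` has exactly one best approximation in `K`.
[cite: Deutsch2001, Def. 2.1] -/
def IsChebyshevSet (K : Set E) : Prop :=
  ∀ x : E, ∃! y, y ∈ K ∧ ∀ z ∈ K, ‖x - y‖ ≤ ‖x - z‖

/-- A Chebyshev set in the set-only sense is exactly one admitting a metric projection `P` with
`IsChebyshevProj K P`. [cite: Deutsch2001, Def. 2.1] -/
theorem isChebyshevSet_iff_exists_proj {K : Set E} :
    IsChebyshevSet K ↔ ∃ P : E → E, IsChebyshevProj K P := by
  constructor
  · intro h
    choose P hP huniq using h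
    refine ⟨P, ⟨fun x => (hP x).1, fun x y hy => (hP x).2 y hy, fun x y hy hle => ?_⟩⟩
    exact huniq x y ⟨hy, fun z hz => hle.trans ((hP x).2 z hz)⟩
  · rintro ⟨P, hP⟩ x
    refine ⟨P x, ⟨hP.mem x, fun z hz => hP.norm_le x hz⟩, fun y hy => ?_⟩
    exact hP.unique x hy.1 (hy.2 _ (hP.mem x))

namespace IsChebyshevProj

variable {K : Set E} {P : E → E}

/-- A Chebyshev set is nonempty. [cite: Deutsch2001, Def. 2.1] -/
theorem nonempty (hP : IsChebyshevProj K P) : K.Nonempty := ⟨P 0, hP.mem 0⟩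

/-- Points of `K` are their own best approximations: `P x = x` for `x ∈ K`.
[cite: Deutsch2001, Def. 2.1] -/
theorem proj_eq_self (hP : IsChebyshevProj K P) {x : E} (hx : x ∈ K) : P x = x :=
  (hP.unique x hx (by rw [sub_self, norm_zero]; exact norm_nonneg _)).symm

/-- `‖x − P x‖ = d(x, K)`. [cite: Deutsch2001, Def. 2.1] -/
theorem norm_sub_proj_eq_infDist (hP : IsChebyshevProj K P) (x : E) :
    ‖x - P x‖ = infDist x K := by
  refine le_antisymm ((le_infDist hP.nonempty).2 fun y hy => ?_) ?_
  · rw [dist_eq_norm]; exact hP.norm_le x hy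
  · simpa [dist_eq_norm] using infDist_le_dist_of_mem (x := x) (hP.mem x)

/-- Any `y ∈ K` realising the distance is `P x`. [cite: Deutsch2001, Def. 2.1] -/
theorem eq_proj_of_norm_le_infDist (hP : IsChebyshevProj K P) {x y : E} (hy : y ∈ K)
    (h : ‖x - y‖ ≤ infDist x K) : y = P x :=
  hP.unique x hy (h.trans_eq (hP.norm_sub_proj_eq_infDist x).symm)

/-- `P z = P x` as soon as `P x` is at least as close to `z` as `P z` is.
[cite: Deutsch2001, Def. 2.1] -/
theorem proj_eq_of_norm_le (hP : IsChebyshevProj K P) {x z : E}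
    (h : ‖z - P x‖ ≤ ‖z - P z‖) : P z = P x :=
  (hP.unique z (hP.mem x) h).symm

/-- A Chebyshev set is closed (proximinal sets are closed). [cite: Deutsch2001, Thm. 3.1] -/
theorem isClosed (hP : IsChebyshevProj K P) : IsClosed K := by
  rw [← closure_subset_iff_isClosed]
  intro x hx
  have h0 : infDist x K = 0 := (mem_closure_iff_infDist_zero hP.nonempty).1 hx
  have h1 : ‖x - P x‖ = 0 := by rw [hP.norm_sub_proj_eq_infDist, h0]
  have hx' : x = P x := sub_eq_zero.1 (norm_eq_zero.1 h1)
  rw [hx']; exact hP.mem x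

/-- Off `K` the distance `‖x − P x‖` is positive. [cite: Deutsch2001, Thm. 3.1] -/
theorem norm_sub_proj_pos (hP : IsChebyshevProj K P) {x : E} (hx : x ∉ K) : 0 < ‖x - P x‖ := by
  refine norm_pos_iff.2 (sub_ne_zero.2 fun h => hx ?_)
  rw [h]; exact hP.mem x

end IsChebyshevProj

/-! ### Lemma 12.1 and Definition 12.2 (real normed spaces) -/

section Segment

variable [NormedSpace ℝ E]

namespace IsChebyshevProj

variable {K : Set E} {P : E → E}

/-- **Lemma 12.1.** Every point `P x + t (x − P x)`, `0 ≤ t ≤ 1`, of the segment joining `x` to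
its best approximation has `P x` as its best approximation (the printed proof uses only the
triangle inequality, so the lemma is stated in a real normed space).
[cite: Deutsch2001, Lemma 12.1] -/
theorem proj_add_smul_eq (hP : IsChebyshevProj K P) (x : E) {t : ℝ} (ht : t ∈ Icc (0 : ℝ) 1) :
    P (P x + t • (x - P x)) = P x := by
  set y := P x + t • (x - P x) with hy
  have h1 : ‖y - P x‖ = t * ‖x - P x‖ := by
    rw [hy, add_sub_cancel_left, norm_smul, Real.norm_of_nonneg ht.1]
  have h2 : ‖x - y‖ = (1 - t) * ‖x - P x‖ := by
    have : x - y = (1 - t) • (x - P x) := by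
      rw [hy, sub_smul, one_smul]; abel
    rw [this, norm_smul, Real.norm_of_nonneg (sub_nonneg.2 ht.2)]
  refine hP.proj_eq_of_norm_le ?_
  have hz := hP.norm_le x (hP.mem y)
  have htri : ‖x - P y‖ ≤ ‖x - y‖ + ‖y - P y‖ := norm_sub_le_norm_sub_add_norm_sub x y (P y)
  rw [h1]
  nlinarith [norm_nonneg (x - P x)]

/-- Lemma 12.1, segment form: `P y = P x` for every `y ∈ [P x, x]`.
[cite: Deutsch2001, Lemma 12.1] -/
theorem proj_eq_of_mem_segment (hP : IsChebyshevProj K P) {x y : E}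
    (hy : y ∈ segment ℝ (P x) x) : P y = P x := by
  rw [segment_eq_image'] at hy
  obtain ⟨t, ht, rfl⟩ := hy
  exact hP.proj_add_smul_eq x ht

end IsChebyshevProj

/-- **Definition 12.2.** The Chebyshev set with metric projection `P` is a **sun** if every
point of the ray from `P x` through `x` has `P x` as its best approximation:
`P (x + t (x − P x)) = P x` for all `x` and `t ≥ 0` (Klee 1953; Efimov–Stechkin 1958). The
predicate only involves the metric projection `P` (which determines `K = {x | P x = x}`).
[cite: Deutsch2001, Def. 12.2] -/
def IsSun (P : E → E) : Prop :=
  ∀ x : E, ∀ ⦃t : ℝ⦄, 0 ≤ t → P (x + t • (x - P x)) = P x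

end Segment

/-! ### Theorem 12.3: suns and convex Chebyshev sets are equivalent -/

section Sun

variable [InnerProductSpace ℝ E] {K : Set E} {P : E → E}

/-- **Theorem 12.3, (1) ⟹ (2).** A convex Chebyshev set is a sun. [cite: Deutsch2001, Thm. 12.3] -/
theorem IsChebyshevProj.isSun_of_convex (hP : IsChebyshevProj K P) (hK : Convex ℝ K) :
    IsSun P := by
  intro x t ht
  set z := x + t • (x - P x) with hz
  refine hP.proj_eq_of_norm_le ?_
  -- `P x` is a best approximation to `z`: compare with a convex combination of `P x` and `P z`
  have ht1 : (0 : ℝ) < 1 + t := by linarith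
  have ht1' : (1 + t) ≠ 0 := ht1.ne'
  set w := P z with hw
  set v := (t / (1 + t)) • P x + (1 / (1 + t)) • w with hv
  have hvK : v ∈ K :=
    hK (hP.mem x) (hP.mem z) (div_nonneg ht ht1.le) (div_nonneg zero_le_one ht1.le)
      (by rw [← add_div, div_eq_one_iff_eq ht1']; ring)
  have hxv : (1 + t) • (x - v) = z - w := by
    rw [hv, hz, smul_sub, smul_add, smul_smul, smul_smul,
      show (1 + t) * (t / (1 + t)) = t by field_simp,
      show (1 + t) * (1 / (1 + t)) = 1 by field_simp, one_smul]
    module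
  have hzPx : z - P x = (1 + t) • (x - P x) := by rw [hz]; module
  have h1 := hP.norm_le x hvK
  rw [hzPx, norm_smul, Real.norm_of_nonneg ht1.le, ← hxv, norm_smul, Real.norm_of_nonneg ht1.le]
  exact mul_le_mul_of_nonneg_left h1 ht1.le

namespace IsSun

/-- **Theorem 12.3, (2) ⟹ (3).** If `K` is a sun then, for every `y ∈ K`, `P x` is the nearest
point to `x` of the segment `[y, P x]`: `‖x − P x‖ ≤ ‖x − (a y + b P x)‖` for `a, b ≥ 0`,
`a + b = 1`. [cite: Deutsch2001, Thm. 12.3] -/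
theorem norm_sub_proj_le (hP : IsChebyshevProj K P) (hS : IsSun P) (x : E) {y : E} (hy : y ∈ K)
    {a b : ℝ} (ha : 0 ≤ a) (hb : 0 ≤ b) (hab : a + b = 1) :
    ‖x - P x‖ ≤ ‖x - (a • y + b • P x)‖ := by
  rcases ha.eq_or_lt with rfl | ha'
  · simp only [zero_add] at hab; simp [hab]
  -- the ray point `x_t`, `t = b / a`, projects to `P x`; compare distances to `y` and to `P x`
  set t := b / a with ht
  have ht0 : 0 ≤ t := div_nonneg hb ha
  set xt := x + t • (x - P x) with hxt
  have hPxt : P xt = P x := hS x ht0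
  have h1 := hP.norm_le xt hy
  rw [hPxt] at h1
  have hat : a * t = b := by rw [ht]; field_simp
  have e1 : a • (xt - P x) = x - P x := by
    have : xt - P x = (1 + t) • (x - P x) := by rw [hxt]; module
    rw [this, smul_smul, show a * (1 + t) = 1 by linarith [hat], one_smul]
  have h1t : a + a * t = 1 := by linarith [hat]
  have e2 : a • (xt - y) = x - (a • y + b • P x) := by
    calc a • (xt - y) = a • (x + t • (x - P x) - y) := by rw [hxt]
      _ = (a + a * t) • x - (a • y + (a * t) • P x) := by module
      _ = x - (a • y + b • P x) := by rw [h1t, one_smul, hat]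
  have n1 : ‖x - P x‖ = a * ‖xt - P x‖ := by
    rw [← e1, norm_smul, Real.norm_of_nonneg ha]
  have n2 : ‖x - (a • y + b • P x)‖ = a * ‖xt - y‖ := by
    rw [← e2, norm_smul, Real.norm_of_nonneg ha]
  rw [n1, n2]
  exact mul_le_mul_of_nonneg_left h1 ha

/-- For `y ∈ K`, `P x` is the nearest point to `x` of the whole segment `[y, P x]`
(Theorem 12.3 (3), segment form). [cite: Deutsch2001, Thm. 12.3] -/
theorem norm_sub_proj_le_of_mem_segment (hP : IsChebyshevProj K P) (hS : IsSun P) (x : E)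
    {y z : E} (hy : y ∈ K) (hz : z ∈ segment ℝ y (P x)) : ‖x - P x‖ ≤ ‖x - z‖ := by
  obtain ⟨a, b, ha, hb, hab, rfl⟩ := hz
  exact hS.norm_sub_proj_le hP x hy ha hb hab

/-- If `‖u‖ ≤ ‖u − s d‖` for all `0 < s ≤ 1` then `⟪u, d⟫ ≤ 0` (first-order condition).
[folklore] -/
private theorem inner_le_zero_of_norm_le {u d : E}
    (h : ∀ s : ℝ, 0 < s → s ≤ 1 → ‖u‖ ≤ ‖u - s • d‖) : ⟪u, d⟫ ≤ 0 := by
  refine le_of_not_gt fun hpos => ?_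
  have hd : 0 < ‖d‖ := by
    refine norm_pos_iff.2 fun hd => ?_
    rw [hd, inner_zero_right] at hpos; exact lt_irrefl _ hpos
  have hd2 : 0 < ‖d‖ ^ 2 := by positivity
  -- for `0 < s ≤ 1`: `2 ⟪u, d⟫ ≤ s ‖d‖²`
  have key : ∀ s : ℝ, 0 < s → s ≤ 1 → 2 * ⟪u, d⟫ ≤ s * ‖d‖ ^ 2 := by
    intro s hs hs1
    have h1 := h s hs hs1
    have h2 : ‖u‖ ^ 2 ≤ ‖u - s • d‖ ^ 2 := by gcongr
    rw [norm_sub_sq_real, inner_smul_right, norm_smul, Real.norm_of_nonneg hs.le] at h2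
    nlinarith
  set s := min 1 (⟪u, d⟫ / ‖d‖ ^ 2) with hs
  have hs0 : 0 < s := lt_min one_pos (div_pos hpos hd2)
  have hs1 : s ≤ 1 := min_le_left _ _
  have hsle : s * ‖d‖ ^ 2 ≤ ⟪u, d⟫ := by
    calc s * ‖d‖ ^ 2 ≤ ⟪u, d⟫ / ‖d‖ ^ 2 * ‖d‖ ^ 2 :=
          mul_le_mul_of_nonneg_right (min_le_right _ _) hd2.le
      _ = ⟪u, d⟫ := by field_simp
  linarith [key s hs0 hs1]

/-- **Theorem 12.3, (3) ⟹ variational inequality.** For a sun, `⟪x − P x, y − P x⟫ ≤ 0` for every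
`y ∈ K` (the characterization of Theorem 4.1 holds on suns). [cite: Deutsch2001, Thm. 12.3] -/
theorem inner_sub_proj_le_zero (hP : IsChebyshevProj K P) (hS : IsSun P) (x : E) {y : E}
    (hy : y ∈ K) : ⟪x - P x, y - P x⟫ ≤ 0 := by
  refine inner_le_zero_of_norm_le fun s hs hs1 => ?_
  have h := hS.norm_sub_proj_le hP x hy hs.le (sub_nonneg.2 hs1) (by ring)
  have e : x - (s • y + (1 - s) • P x) = x - P x - s • (y - P x) := by module
  rwa [e] at h

/-- **Theorem 12.3, (3) ⟹ (4), firm form.** The metric projection onto a sun is firmly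
nonexpansive: `‖P x − P y‖² ≤ ⟪x − y, P x − P y⟫`. [cite: Deutsch2001, Thm. 12.3] -/
theorem norm_proj_sub_proj_sq_le_inner (hP : IsChebyshevProj K P) (hS : IsSun P) (x y : E) :
    ‖P x - P y‖ ^ 2 ≤ ⟪x - y, P x - P y⟫ := by
  have h1 := hS.inner_sub_proj_le_zero hP x (hP.mem y)
  have h2 := hS.inner_sub_proj_le_zero hP y (hP.mem x)
  have e1 : ⟪x - P x, P y - P x⟫ = -⟪x, P x - P y⟫ + ⟪P x, P x - P y⟫ := by
    rw [show P y - P x = -(P x - P y) by abel, inner_neg_right, inner_sub_left]; ring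
  have e2 : ⟪y - P y, P x - P y⟫ = ⟪y, P x - P y⟫ - ⟪P y, P x - P y⟫ := by
    rw [inner_sub_left]
  have e3 : ‖P x - P y‖ ^ 2 = ⟪P x, P x - P y⟫ - ⟪P y, P x - P y⟫ := by
    rw [← inner_sub_left, real_inner_self_eq_norm_sq]
  have e4 : ⟪x - y, P x - P y⟫ = ⟪x, P x - P y⟫ - ⟪y, P x - P y⟫ := by rw [inner_sub_left]
  linarith

/-- **Theorem 12.3, (2)/(3) ⟹ (4).** The metric projection onto a sun is nonexpansive:
`‖P x − P y‖ ≤ ‖x − y‖`. [cite: Deutsch2001, Thm. 12.3] -/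
theorem norm_proj_sub_proj_le (hP : IsChebyshevProj K P) (hS : IsSun P) (x y : E) :
    ‖P x - P y‖ ≤ ‖x - y‖ := by
  have h := hS.norm_proj_sub_proj_sq_le_inner hP x y
  have hcs := real_inner_le_norm (x - y) (P x - P y)
  refine le_of_not_gt fun hlt => ?_
  have hpos : 0 < ‖P x - P y‖ := (norm_nonneg _).trans_lt hlt
  have : ‖x - y‖ * ‖P x - P y‖ < ‖P x - P y‖ * ‖P x - P y‖ := mul_lt_mul_of_pos_right hlt hpos
  nlinarith

end IsSun

/-- **Theorem 12.3, (4) ⟹ (1)** (Phelps 1957). A Chebyshev set whose metric projection is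
nonexpansive is convex: for `x, y ∈ K` and `z = a x + b y`, nonexpansiveness pins `P z` at distance
`≤ b‖y − x‖` from `x` and `≤ a‖y − x‖` from `y`, and the equality case of the triangle inequality in
an inner product space forces `P z = z`. [cite: Deutsch2001, Thm. 12.3] -/
theorem IsChebyshevProj.convex_of_nonexpansive (hP : IsChebyshevProj K P)
    (h : ∀ x y, ‖P x - P y‖ ≤ ‖x - y‖) : Convex ℝ K := by
  intro x hx y hy a b ha hb hab
  set z := a • x + b • y with hz
  -- `p = P z − x`, `q = y − P z`, `p + q = d = y − x`
  set d := y - x with hd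
  set p := P z - x with hp
  set q := y - P z with hq
  have hpq : p + q = d := by rw [hp, hq, hd]; abel
  have hzx : z - x = b • d := by
    rw [hz, hd, show a = 1 - b by linarith]; module
  have hyz : y - z = a • d := by
    rw [hz, hd, show b = 1 - a by linarith]; module
  have h1 : ‖p‖ ≤ b * ‖d‖ := by
    have := h z x
    rw [hP.proj_eq_self hx, hzx, norm_smul, Real.norm_of_nonneg hb] at this
    exact this
  have h2 : ‖q‖ ≤ a * ‖d‖ := by
    have := h y z
    rw [hP.proj_eq_self hy, hyz, norm_smul, Real.norm_of_nonneg ha] at this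
    exact this
  have h1' : ‖p‖ ^ 2 ≤ (b * ‖d‖) ^ 2 := by gcongr
  have h2' : ‖q‖ ^ 2 ≤ (a * ‖d‖) ^ 2 := by gcongr
  -- `‖d‖² = ‖p‖² + 2⟪p, q⟫ + ‖q‖²` and `‖p − b d‖² = a‖p‖² + b‖q‖² − ab‖d‖² ≤ 0`
  have e1 : ‖d‖ ^ 2 = ‖p‖ ^ 2 + 2 * ⟪p, q⟫ + ‖q‖ ^ 2 := by rw [← hpq, norm_add_sq_real]
  have e2 : ‖p - b • d‖ ^ 2 = ‖p‖ ^ 2 - 2 * b * (‖p‖ ^ 2 + ⟪p, q⟫) + b ^ 2 * ‖d‖ ^ 2 := by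
    rw [norm_sub_sq_real, inner_smul_right, norm_smul, Real.norm_of_nonneg hb, ← hpq,
      inner_add_right, real_inner_self_eq_norm_sq, hpq]
    ring
  have e3 : ‖p - b • d‖ ^ 2 = a * ‖p‖ ^ 2 + b * ‖q‖ ^ 2 - a * b * ‖d‖ ^ 2 := by
    rw [e2, show a = 1 - b by linarith]
    linear_combination b * e1
  have h3 : ‖p - b • d‖ ^ 2 ≤ 0 := by
    rw [e3]
    nlinarith [mul_nonneg ha hb, mul_nonneg (mul_nonneg ha hb) (sq_nonneg ‖d‖),
      mul_le_mul_of_nonneg_left h1' ha, mul_le_mul_of_nonneg_left h2' hb]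
  have h4 : p = b • d := by
    have h5 : ‖p - b • d‖ ^ 2 = 0 := le_antisymm h3 (sq_nonneg _)
    have : ‖p - b • d‖ = 0 := (pow_eq_zero_iff (n := 2) (by norm_num)).1 h5
    exact sub_eq_zero.1 (norm_eq_zero.1 this)
  have hPz : P z = z := by
    have : P z = x + p := by rw [hp]; abel
    rw [this, h4, ← hzx]; abel
  rw [← hPz]; exact hP.mem z

/-- **Theorem 12.3, (1) ⟺ (2).** A Chebyshev set is convex iff it is a sun.
[cite: Deutsch2001, Thm. 12.3] -/
theorem IsChebyshevProj.convex_iff_isSun (hP : IsChebyshevProj K P) : Convex ℝ K ↔ IsSun P :=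
  ⟨hP.isSun_of_convex, fun hS => hP.convex_of_nonexpansive (hS.norm_proj_sub_proj_le hP)⟩

/-- **Theorem 12.3, (1) ⟺ (4).** A Chebyshev set is convex iff its metric projection is
nonexpansive. [cite: Deutsch2001, Thm. 12.3] -/
theorem IsChebyshevProj.convex_iff_nonexpansive (hP : IsChebyshevProj K P) :
    Convex ℝ K ↔ ∀ x y, ‖P x - P y‖ ≤ ‖x - y‖ :=
  ⟨fun hK => (hP.isSun_of_convex hK).norm_proj_sub_proj_le hP, hP.convex_of_nonexpansive⟩

/-- On a convex Chebyshev set the metric projection satisfies the variational inequality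
`⟪x − P x, y − P x⟫ ≤ 0`, `y ∈ K` (Theorem 4.1 via Theorem 12.3). [cite: Deutsch2001, Thm. 12.3] -/
theorem IsChebyshevProj.inner_sub_proj_le_zero_of_convex (hP : IsChebyshevProj K P)
    (hK : Convex ℝ K) (x : E) {y : E} (hy : y ∈ K) : ⟪x - P x, y - P x⟫ ≤ 0 :=
  (hP.isSun_of_convex hK).inner_sub_proj_le_zero hP x hy

end Sun

/-! ### Approximative and bounded compactness (Def. 3.3, Def. 3.10, Lemma 3.11) -/

/-- **Definition 3.3 (2).** `K` is **approximatively compact**: for every `x`, every minimizing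
sequence `(uₙ) ⊆ K` (`‖x − uₙ‖ → d(x, K)`) has a subsequence converging to a point of `K`.
[cite: Deutsch2001, Def. 3.3] -/
def IsApproxCompact (K : Set E) : Prop :=
  ∀ x : E, ∀ u : ℕ → E, (∀ n, u n ∈ K) → Tendsto (fun n => ‖x - u n‖) atTop (𝓝 (infDist x K)) →
    ∃ y ∈ K, ∃ φ : ℕ → ℕ, StrictMono φ ∧ Tendsto (u ∘ φ) atTop (𝓝 y)

/-- **Definition 3.10.** `K` is **boundedly compact**: its intersection with every closed ball
`B[0, r]` is compact (equivalently, in a metric space, every bounded sequence in `K` has a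
subsequence converging to a point of `K`). [cite: Deutsch2001, Def. 3.10] -/
def IsBoundedlyCompact (K : Set E) : Prop :=
  ∀ r : ℝ, IsCompact (K ∩ closedBall (0 : E) r)

namespace IsBoundedlyCompact

variable {K : Set E}

/-- A boundedly compact set meets every closed ball in a compact set.
[cite: Deutsch2001, Def. 3.10] -/
theorem isCompact_inter_closedBall (hK : IsBoundedlyCompact K) (c : E) (r : ℝ) :
    IsCompact (K ∩ closedBall c r) := by
  have hsub : closedBall c r ⊆ closedBall (0 : E) (‖c‖ + r) := by
    intro y hy
    rw [mem_closedBall, dist_zero_right]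
    rw [mem_closedBall, dist_eq_norm] at hy
    calc ‖y‖ = ‖(y - c) + c‖ := by rw [sub_add_cancel]
      _ ≤ ‖y - c‖ + ‖c‖ := norm_add_le _ _
      _ ≤ r + ‖c‖ := by gcongr
      _ = ‖c‖ + r := add_comm _ _
  have h : K ∩ closedBall c r = (K ∩ closedBall 0 (‖c‖ + r)) ∩ closedBall c r := by
    rw [inter_assoc, inter_eq_right.2 hsub]
  rw [h]
  exact (hK _).inter_right isClosed_closedBall

/-- **Lemma 3.11, (2) ⟹ (3).** A boundedly compact set is approximatively compact (minimizing
sequences are bounded). [cite: Deutsch2001, Lemma 3.11] -/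
theorem isApproxCompact (hK : IsBoundedlyCompact K) : IsApproxCompact K := by
  intro x u hu hlim
  obtain ⟨M, hM⟩ := hlim.bddAbove_range
  have hmem : ∀ n, u n ∈ K ∩ closedBall x M := fun n =>
    ⟨hu n, by
      rw [mem_closedBall, dist_comm, dist_eq_norm]
      exact hM ⟨n, rfl⟩⟩
  obtain ⟨y, hy, φ, hφ, h⟩ := (hK.isCompact_inter_closedBall x M).tendsto_subseq hmem
  exact ⟨y, hy.1, φ, hφ, h⟩

/-- In a finite-dimensional space every closed set is boundedly compact (closed bounded subsets
of a finite-dimensional space are compact). [cite: Deutsch2001, Thm. 3.12] -/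
theorem of_isClosed [NormedSpace ℝ E] [FiniteDimensional ℝ E] (hK : IsClosed K) :
    IsBoundedlyCompact K :=
  fun r => (isCompact_closedBall (0 : E) r).inter_left hK

end IsBoundedlyCompact

/-! ### Lemma 12.4: continuity of the metric projection -/

namespace IsChebyshevProj

variable {K : Set E} {P : E → E}

/-- **Lemma 12.4.** The metric projection onto an approximatively compact Chebyshev set is
continuous: if `xₙ → x` then `(P xₙ)` is a minimizing sequence for `x`, every subsequence of which
has a subsequence converging to the unique best approximation `P x`.
[cite: Deutsch2001, Lemma 12.4] -/
theorem continuous (hP : IsChebyshevProj K P) (hK : IsApproxCompact K) : Continuous P := by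
  refine continuous_iff_seqContinuous.2 fun u x hux => ?_
  refine tendsto_of_subseq_tendsto fun ns hns => ?_
  set w : ℕ → E := fun k => u (ns k) with hw
  have hwx : Tendsto w atTop (𝓝 x) := hux.comp hns
  have h0 : Tendsto (fun k => ‖w k - x‖) atTop (𝓝 0) := tendsto_iff_norm_sub_tendsto_zero.1 hwx
  have hmin : Tendsto (fun k => ‖x - P (w k)‖) atTop (𝓝 (infDist x K)) := by
    rw [← hP.norm_sub_proj_eq_infDist x]
    refine tendsto_of_tendsto_of_tendsto_of_le_of_le (g := fun _ => ‖x - P x‖)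
      (h := fun k => 2 * ‖w k - x‖ + ‖x - P x‖) tendsto_const_nhds ?_
      (fun k => hP.norm_le x (hP.mem (w k))) (fun k => ?_)
    · have : Tendsto (fun k => 2 * ‖w k - x‖ + ‖x - P x‖) atTop (𝓝 (2 * 0 + ‖x - P x‖)) :=
        (h0.const_mul 2).add tendsto_const_nhds
      simpa using this
    · calc ‖x - P (w k)‖ ≤ ‖x - w k‖ + ‖w k - P (w k)‖ := norm_sub_le_norm_sub_add_norm_sub _ _ _
        _ ≤ ‖x - w k‖ + ‖w k - P x‖ := by gcongr; exact hP.norm_le (w k) (hP.mem x)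
        _ ≤ ‖x - w k‖ + (‖w k - x‖ + ‖x - P x‖) := by
            gcongr; exact norm_sub_le_norm_sub_add_norm_sub _ _ _
        _ = 2 * ‖w k - x‖ + ‖x - P x‖ := by rw [norm_sub_rev x (w k)]; ring
  obtain ⟨y, hyK, φ, hφ, hlim⟩ := hK x (fun k => P (w k)) (fun k => hP.mem (w k)) hmin
  have hy : y = P x := by
    refine hP.eq_proj_of_norm_le_infDist hyK (le_of_eq ?_)
    have h1 : Tendsto (fun k => ‖x - P (w (φ k))‖) atTop (𝓝 ‖x - y‖) :=
      (tendsto_const_nhds.sub hlim).norm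
    have h2 : Tendsto (fun k => ‖x - P (w (φ k))‖) atTop (𝓝 (infDist x K)) :=
      hmin.comp hφ.tendsto_atTop
    exact tendsto_nhds_unique h1 h2
  refine ⟨φ, ?_⟩
  rw [← hy]
  exact hlim

/-- Lemma 12.4 with Lemma 3.11: the metric projection onto a boundedly compact Chebyshev set is
continuous. [cite: Deutsch2001, Lemma 12.4] -/
theorem continuous_of_isBoundedlyCompact (hP : IsChebyshevProj K P) (hK : IsBoundedlyCompact K) :
    Continuous P :=
  hP.continuous hK.isApproxCompact

end IsChebyshevProj

/-! ### Theorem 12.6: boundedly compact Chebyshev sets are suns, hence convex -/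

section Vlasov

variable [NormedSpace ℝ E] {K : Set E} {P : E → E}

/-- **Theorem 12.6, sun form** (Vlasov 1961; Ch. 12, Exercise 7: "every boundedly compact
Chebyshev set in a normed linear space is a sun"). Proof as printed for Theorem 12.6 — it uses only
the norm, so it is stated in a real normed space: if the ray from `P x`
through `x ∉ K` contained points not projecting to `P x`, let `x₁ = x + λ₁ (x − P x)` be the last
point projecting to `P x` (`λ₁` = the supremum of the closed bounded set of good parameters),
`r = d(x₁, K)/2`, and `F y = x₁ + (r/‖x₁ − P y‖)(x₁ − P y)` on the ball `B[x₁, r]`: `F` is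
continuous (`P` is, Lemma 12.4), maps the ball into itself and has range in the compact set
`{x₁ + (r/‖x₁ − v‖)(x₁ − v) : v ∈ K ∩ B[x₁, R]}`; a fixed point `x₀` (Schauder, Theorem 12.5 —
the tree's `exists_fixedPoint_of_mapsTo_isCompact`) has `x₁ ∈ [x₀, P x₀]`, so `P x₁ = P x₀` by
Lemma 12.1, and then `x₀ = x₁ + μ (x₁ − P x₁)` with `μ > 0` projects to `P x₁`, contradicting the
choice of `x₁`. [cite: Deutsch2001, Thm. 12.6] -/
theorem IsChebyshevProj.isSun_of_isBoundedlyCompact (hP : IsChebyshevProj K P)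
    (hK : IsBoundedlyCompact K) : IsSun P := by
  have hPc : Continuous P := hP.continuous_of_isBoundedlyCompact hK
  intro x
  by_cases hxK : x ∈ K
  · intro t _
    rw [hP.proj_eq_self hxK, sub_self, smul_zero, add_zero]
    exact hP.proj_eq_self hxK
  intro t₀ ht₀
  by_contra hne
  have hc : 0 < ‖x - P x‖ := hP.norm_sub_proj_pos hxK
  -- the set of good parameters on the ray `s ↦ x + s (x - P x)`
  set S : Set ℝ := {s | 0 ≤ s ∧ ‖x + s • (x - P x) - P x‖ ≤ infDist (x + s • (x - P x)) K}
    with hS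
  have memS : ∀ {s : ℝ}, s ∈ S ↔ 0 ≤ s ∧ P (x + s • (x - P x)) = P x := by
    intro s
    simp only [hS, mem_setOf_eq]
    refine ⟨fun h => ⟨h.1, ?_⟩, fun h => ⟨h.1, ?_⟩⟩
    · exact hP.proj_eq_of_norm_le (h.2.trans_eq (hP.norm_sub_proj_eq_infDist _).symm)
    · rw [← hP.norm_sub_proj_eq_infDist, h.2]
  have hSclosed : IsClosed S := by
    have hr : Continuous fun s : ℝ => x + s • (x - P x) :=
      continuous_const.add (continuous_id.smul continuous_const)
    exact isClosed_Ici.inter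
      (isClosed_le (hr.sub continuous_const).norm ((continuous_infDist_pt (s := K)).comp hr))
  have h0S : (0 : ℝ) ∈ S := memS.2 ⟨le_rfl, by rw [zero_smul, add_zero]⟩
  -- the ray: `x + s (x - P x) - P x = (1 + s) (x - P x)`
  have hray : ∀ s : ℝ, x + s • (x - P x) - P x = (1 + s) • (x - P x) := fun s => by module
  -- good parameters form an initial segment (Lemma 12.1)
  have hdown : ∀ {s μ : ℝ}, s ∈ S → 0 ≤ μ → μ ≤ s → μ ∈ S := by
    intro s μ hs hμ hμs
    obtain ⟨hs0, hPs⟩ := memS.1 hs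
    refine memS.2 ⟨hμ, ?_⟩
    have h1s : (0 : ℝ) < 1 + s := by linarith
    have hτ : (1 + μ) / (1 + s) ∈ Icc (0 : ℝ) 1 :=
      ⟨div_nonneg (by linarith) h1s.le, (div_le_one h1s).2 (by linarith)⟩
    have key := hP.proj_add_smul_eq (x + s • (x - P x)) hτ
    rw [hPs, hray s, smul_smul, div_mul_cancel₀ _ h1s.ne'] at key
    have e : P x + (1 + μ) • (x - P x) = x + μ • (x - P x) := by module
    rwa [e] at key
  have hbdd : BddAbove S :=
    ⟨t₀, fun s hs => le_of_not_gt fun hlt => hne (memS.1 (hdown hs ht₀ hlt.le)).2⟩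
  -- the last good parameter `λ₁` and the point `x₁`
  set l : ℝ := sSup S with hl
  have hlS : l ∈ S := hSclosed.csSup_mem ⟨0, h0S⟩ hbdd
  obtain ⟨hl0, hPl⟩ := memS.1 hlS
  have hbeyond : ∀ s : ℝ, l < s → P (x + s • (x - P x)) ≠ P x := by
    intro s hs h
    have : s ∈ S := memS.2 ⟨hl0.trans hs.le, h⟩
    exact (lt_irrefl _) (hs.trans_le (le_csSup hbdd this))
  set x₁ : E := x + l • (x - P x) with hx₁
  have hPx₁ : P x₁ = P x := hPl
  have hx₁ray : x₁ - P x₁ = (1 + l) • (x - P x) := by rw [hPx₁, hx₁]; exact hray l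
  have KEY : ∀ μ : ℝ, 0 < μ → P (x₁ + μ • (x₁ - P x₁)) ≠ P x₁ := by
    intro μ hμ
    have e : x₁ + μ • (x₁ - P x₁) = x + (l + μ * (1 + l)) • (x - P x) := by
      rw [hx₁ray, hx₁]; module
    rw [e, hPx₁]
    exact hbeyond _ (by nlinarith)
  -- `δ = d(x₁, K) > 0`, `ρ = δ / 2`
  set δ : ℝ := ‖x₁ - P x₁‖ with hδ
  have hδpos : 0 < δ := by
    rw [hδ, hx₁ray, norm_smul, Real.norm_of_nonneg (by linarith : (0 : ℝ) ≤ 1 + l)]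
    exact mul_pos (by linarith) hc
  have hden : ∀ y : E, δ ≤ ‖x₁ - P y‖ := fun y => hP.norm_le x₁ (hP.mem y)
  have hdenpos : ∀ y : E, 0 < ‖x₁ - P y‖ := fun y => hδpos.trans_le (hden y)
  set ρ : ℝ := δ / 2 with hρ
  have hρpos : 0 < ρ := by positivity
  -- the map `F`
  set F : E → E := fun y => x₁ + (ρ / ‖x₁ - P y‖) • (x₁ - P y) with hF
  have hFnorm : ∀ y, ‖F y - x₁‖ = ρ := by
    intro y
    simp only [hF, add_sub_cancel_left, norm_smul, Real.norm_of_nonneg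
      (div_nonneg hρpos.le (norm_nonneg _))]
    exact div_mul_cancel₀ ρ (hdenpos y).ne'
  have hFc : Continuous F := by
    have h1 : Continuous fun y => x₁ - P y := continuous_const.sub hPc
    exact continuous_const.add ((continuous_const.div h1.norm fun y => (hdenpos y).ne').smul h1)
  have hmapsB : MapsTo F (closedBall x₁ ρ) (closedBall x₁ ρ) := by
    intro y _
    rw [mem_closedBall, dist_eq_norm, hFnorm y]
  -- compact range
  set R : ℝ := 2 * ρ + δ with hR
  set g : E → E := fun v => x₁ + (ρ / ‖x₁ - v‖) • (x₁ - v) with hg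
  have hgc : ContinuousOn g (K ∩ closedBall x₁ R) := by
    have h1 : Continuous fun v : E => x₁ - v := continuous_const.sub continuous_id
    have hne' : ∀ v ∈ K ∩ closedBall x₁ R, ‖x₁ - v‖ ≠ 0 := fun v hv =>
      (hδpos.trans_le (hP.norm_le x₁ hv.1)).ne'
    exact continuousOn_const.add
      ((continuousOn_const.div h1.norm.continuousOn hne').smul h1.continuousOn)
  have hSc : IsCompact (g '' (K ∩ closedBall x₁ R)) :=
    (hK.isCompact_inter_closedBall x₁ R).image_of_continuousOn hgc
  have hmapsS : MapsTo F (closedBall x₁ ρ) (g '' (K ∩ closedBall x₁ R)) := by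
    intro y hy
    refine ⟨P y, ⟨hP.mem y, ?_⟩, rfl⟩
    rw [mem_closedBall, dist_eq_norm] at hy ⊢
    have h1 : ‖y - P y‖ ≤ ‖y - P x₁‖ := hP.norm_le y (hP.mem x₁)
    have h2 : ‖y - P x₁‖ ≤ ‖y - x₁‖ + ‖x₁ - P x₁‖ := norm_sub_le_norm_sub_add_norm_sub _ _ _
    calc ‖P y - x₁‖ ≤ ‖P y - y‖ + ‖y - x₁‖ := norm_sub_le_norm_sub_add_norm_sub _ _ _
      _ = ‖y - P y‖ + ‖y - x₁‖ := by rw [norm_sub_rev]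
      _ ≤ (ρ + δ) + ρ := by linarith
      _ = R := by rw [hR]; ring
  -- Schauder's fixed point theorem (Theorem 12.5)
  obtain ⟨x₀, -, hfix⟩ := exists_fixedPoint_of_mapsTo_isCompact (convex_closedBall x₁ ρ)
    isClosed_closedBall ⟨x₁, mem_closedBall_self hρpos.le⟩ hSc hFc.continuousOn hmapsB hmapsS
  -- `x₁ ∈ [x₀, P x₀]`, hence `P x₁ = P x₀` (Lemma 12.1)
  set s : ℝ := ‖x₁ - P x₀‖ with hs
  have hspos : 0 < s := hdenpos x₀
  have hsρ : 0 < s + ρ := add_pos hspos hρpos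
  have hs0 : s ≠ 0 := hspos.ne'
  have hfix' : x₁ + (ρ / s) • (x₁ - P x₀) = x₀ := hfix
  have hτ : s / (s + ρ) ∈ Icc (0 : ℝ) 1 :=
    ⟨div_nonneg hspos.le hsρ.le, (div_le_one hsρ).2 (by linarith)⟩
  have e1 : x₀ - P x₀ = (1 + ρ / s) • (x₁ - P x₀) := by
    rw [add_smul, one_smul]
    nth_rewrite 1 [← hfix']
    abel
  have e2 : P x₀ + (s / (s + ρ)) • (x₀ - P x₀) = x₁ := by
    rw [e1, smul_smul, show s / (s + ρ) * (1 + ρ / s) = 1 by field_simp, one_smul]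
    abel
  have hP10 : P x₁ = P x₀ := by
    have := hP.proj_add_smul_eq x₀ hτ
    rwa [e2] at this
  -- contradiction: `x₀ = x₁ + μ (x₁ - P x₁)` with `μ = ρ / s > 0` projects to `P x₁`
  have e3 : x₁ + (ρ / s) • (x₁ - P x₁) = x₀ := by rw [hP10]; exact hfix'
  exact KEY (ρ / s) (div_pos hρpos hspos) (by rw [e3, hP10])

end Vlasov

section Convexity

variable [InnerProductSpace ℝ E] {K : Set E} {P : E → E}

namespace IsChebyshevProj

/-- **Theorem 12.6 (boundedly compact Chebyshev sets are convex).** If `K` is a boundedly compact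
Chebyshev set in a real inner product space, then `K` is convex (Vlasov 1961 / Klee 1961;
Theorems 12.3 and 12.6). [cite: Deutsch2001, Thm. 12.6] -/
theorem convex_of_isBoundedlyCompact (hP : IsChebyshevProj K P) (hK : IsBoundedlyCompact K) :
    Convex ℝ K :=
  hP.convex_iff_isSun.2 (hP.isSun_of_isBoundedlyCompact hK)

/-- **Theorem 12.7, "only if".** In a finite-dimensional real inner product space every Chebyshev
set is convex (Bunt 1934, Motzkin 1935, Kritikos 1938, Jessen 1940).
[cite: Deutsch2001, Thm. 12.7] -/
theorem convex_of_finiteDimensional [FiniteDimensional ℝ E] (hP : IsChebyshevProj K P) :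
    Convex ℝ K :=
  hP.convex_of_isBoundedlyCompact (IsBoundedlyCompact.of_isClosed hP.isClosed)

/-- Theorem 12.7 with Theorem 12.3: the metric projection onto a Chebyshev set of a
finite-dimensional real inner product space is nonexpansive. [cite: Deutsch2001, Thm. 12.7] -/
theorem norm_proj_sub_proj_le_of_finiteDimensional [FiniteDimensional ℝ E]
    (hP : IsChebyshevProj K P) (x y : E) : ‖P x - P y‖ ≤ ‖x - y‖ :=
  hP.convex_iff_nonexpansive.1 hP.convex_of_finiteDimensional x y

end IsChebyshevProj

/-! ### Theorem 3.5 / Theorem 12.7: closed convex sets are Chebyshev -/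

/-- **Theorem 3.4 (2) (with Theorem 2.4).** A nonempty complete convex subset of a real inner
product space is a Chebyshev set, with metric projection the tree's
`Literature.Analysis.Convex.ConvexMetricProjection.proj K` (existence from Mathlib's
`exists_norm_eq_iInf_of_complete_convex`, uniqueness Theorem 2.4). [cite: Deutsch2001, Thm. 3.4] -/
theorem isChebyshevProj_proj (hne : K.Nonempty) (hK : IsComplete K) (hconv : Convex ℝ K) :
    IsChebyshevProj K (ConvexMetricProjection.proj K) :=
  ⟨fun x => ConvexMetricProjection.proj_mem hne hK hconv x,
    fun x _ hy => ConvexMetricProjection.norm_sub_proj_le hne hK hconv x hy,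
    fun x _ hy hle => ConvexMetricProjection.eq_proj_of_norm_sub_le hne hK hconv hy fun _ hz =>
      hle.trans (ConvexMetricProjection.norm_sub_proj_le hne hK hconv x hz)⟩

/-- **Theorem 3.4 (2).** A nonempty complete convex set is a Chebyshev set.
[cite: Deutsch2001, Thm. 3.4] -/
theorem exists_isChebyshevProj_of_isComplete (hne : K.Nonempty) (hK : IsComplete K)
    (hconv : Convex ℝ K) : ∃ P : E → E, IsChebyshevProj K P :=
  ⟨_, isChebyshevProj_proj hne hK hconv⟩

/-- **Theorem 3.5.** Every nonempty closed convex subset of a real Hilbert space is a Chebyshev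
set. [cite: Deutsch2001, Thm. 3.5] -/
theorem exists_isChebyshevProj_of_convex [CompleteSpace E] (hne : K.Nonempty) (hK : IsClosed K)
    (hconv : Convex ℝ K) : ∃ P : E → E, IsChebyshevProj K P :=
  exists_isChebyshevProj_of_isComplete hne hK.isComplete hconv

/-- **Theorem 12.7 (convexity of Chebyshev sets in finite-dimensional spaces).** In a
finite-dimensional real inner product space, a nonempty set is a Chebyshev set if and only if it is
closed and convex. [cite: Deutsch2001, Thm. 12.7] -/
theorem isChebyshevSet_iff_isClosed_and_convex [FiniteDimensional ℝ E] (hne : K.Nonempty) :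
    IsChebyshevSet K ↔ IsClosed K ∧ Convex ℝ K := by
  rw [isChebyshevSet_iff_exists_proj]
  constructor
  · rintro ⟨P, hP⟩
    exact ⟨hP.isClosed, hP.convex_of_finiteDimensional⟩
  · rintro ⟨hcl, hconv⟩
    haveI : CompleteSpace E := FiniteDimensional.complete ℝ E
    exact exists_isChebyshevProj_of_convex hne hcl hconv

end Convexity

end Literature.Analysis.Convex.ChebyshevSetConvexity
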